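import Summits.CriticalPhenomena.SAWScalingLimit.Theses.SAWWeldingIdentification
import Summits.CriticalPhenomena.SAWScalingLimit.Theses.SAWLoopFugacityFlow
import Summits.CriticalPhenomena.SAWScalingLimit.Theorems.SAWWeldingIdentificationSLERemovableChord
import Summits.CriticalPhenomena.SAWScalingLimit.Theorems.SAWWeldingIdentificationRemovableLimitIdle
import Summits.CriticalPhenomena.SAWScalingLimit.Theorems.SimpleSubseqLimits.Negative.SimpleSubseqLimitsNecessary
import Summits.CriticalPhenomena.SAWScalingLimit.Theorems.SAWWeldingIdentificationRemovableLimitAnalyticNull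
import Summits.CriticalPhenomena.SAWScalingLimit.Theorems.SAWWeldingIdentificationRemovableLimitHolomorphyBorel
import Summits.CriticalPhenomena.SAWScalingLimit.Theorems.SAWWeldingIdentificationRemovableLimitInjectiveBorel
import Summits.CriticalPhenomena.SAWScalingLimit.Theorems.SAWWeldingIdentificationRemovableLimitAnalyticNotRemovable
import HarnessLib

/-!
# Removability transfers to the SLE law: `RemovableLimit` ⟸ `SubseqIdentification` ⟸ (W)

Route `SAWWeldingIdentification` of `CriticalPhenomena/SAWScalingLimit`, crux (R) `RemovableLimit`
(stmt-CriticalPhenomena-4503): every subsequential weak limit `P` of the critical `δℤ²` SAW laws in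
a conformal rectangle `Q` is carried by SIMPLE CHORDS of `(Ω; a, b) = Q.chord 0 2` that are
CONFORMALLY REMOVABLE inside `Ω`.

Up to this file the tree knew removability of chordal SLE₈/₃ only ALMOST SURELY IN THE DRIVING
PATH `ω` (`SLERemovableChord_proof`, `isConformallyRemovableIn_range_of_isCompactifiedImage`:
Rohde–Schramm 2005 Thm 5.2 Hölder banks + local Jones–Smirnov), and every lead seat on the crux
recorded the same obstruction to reading it on the LAW `ℙ ∘ Γ⁻¹`: the set of removable curves is
only co-analytic in `CurveClass ℂ`, so `ae_map_iff` does not apply (this is also why the route's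
Lusin–Souslin item had to be restated as `IdentifyFromWeldingAE`, stmt-11091). This file removes
the obstruction by descriptive set theory, using the four stub files of line `registered` (v3):

* `ae_map_notMem_of_analyticSet` — if a random element a.s. avoids an ANALYTIC set then its law
  gives the set measure zero (from `stub_measure_eq_zero_of_analyticSet`: finite Borel measures on
  Hausdorff spaces are inner regular by compact sets on analytic sets — Choquet/Lusin);
* `analyticSet_setOf_not_isConformallyRemovableIn` — for open `Ω`, the set of curve classes whose
  trace is NOT conformally removable inside `Ω` is analytic (projection of a Borel set of pairs
  `(γ, g)`, `g ∈ C(Ω, ℂ)` injective, holomorphic off the trace, not holomorphic on `Ω`: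
  `stub_measurableSet_differentiableOn`, `stub_measurableSet_injective`,
  `stub_analyticSet_not_removable_of_measurable`);
* `ae_isConformallyRemovableIn_of_isSLELaw` — hence for `0 < κ < 4` every chordal SLE_κ LAW is
  carried by curves with conformally removable trace (RS05 Thm 5.2 / 6.1 + Jones–Smirnov, now on
  the law side);
* `ae_removableSimpleChord_of_isSLELaw` — an SLE₈/₃ law in `Q.chord 0 2` satisfies the conclusion
  of the crux verbatim;
* `removableLimit_of_subseqIdentification`, `removableLimit_of_weldingLawOfLimit`,
  `removableLimit_of_sawScalingLimit` — (R) follows from the shared crux stmt-0783, from THIS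
  route's rank-2 crux (W) alone (via `isSLELaw_of_weldingLawOfLimit`, p145305), and from the summit
  conjunct (honesty certificate). So (R) is REDUNDANT in its only route: it closes by a one-line
  proof the moment stmt-CriticalPhenomena-4502 closes.

References: Kechris, *Classical Descriptive Set Theory* (1995), Thms 14.2, 29.7, 30.13;
[RohdeSchramm2005] Thm 5.2, Thm 6.1; [JonesSmirnov2000] Cor. 2; [Younsi2018].
-/

noncomputable section

open MeasureTheory Filter Set Metric
open scoped Topology NNReal
open Literature.Probability.RandomPlanarGeometry Literature.Probability.LatticeModels
open Literature.Probability.Process (preWienerMeasure)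
open Summit.CriticalPhenomena.SAWScalingLimit.Theses

namespace Summit.CriticalPhenomena.SAWScalingLimit.Theorems.RemovableLimit

/-! ### The push-forward transfer through an analytic set -/

/-- **If a random element almost surely avoids an analytic set, its law gives the set measure
zero.** Let `Γ : Ω → X` be a.e.-measurable under a finite measure `P`, `X` Hausdorff with its Borel
σ-algebra, and `s ⊆ X` analytic (not necessarily Borel). If `P`-a.s. `Γ ω ∉ s` then
`(P.map Γ)`-a.e. `x ∉ s`: every compact `K ⊆ s` is Borel with `P (Γ ⁻¹' K) = 0`, and a finite Borel
measure vanishing on the compact subsets of an analytic set vanishes on it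
(`stub_measure_eq_zero_of_analyticSet`). [folklore] -/
theorem ae_map_notMem_of_analyticSet {Ω X : Type*} [MeasurableSpace Ω] {P : Measure Ω}
    [IsFiniteMeasure P] [TopologicalSpace X] [T2Space X] [MeasurableSpace X] [BorelSpace X]
    {Γ : Ω → X} (hΓ : AEMeasurable Γ P) {s : Set X} (hs : AnalyticSet s)
    (h : ∀ᵐ ω ∂P, Γ ω ∉ s) : ∀ᵐ x ∂(P.map Γ), x ∉ s := by
  haveI : IsFiniteMeasure (P.map Γ) := Measure.isFiniteMeasure_map P Γ
  have hzero : (P.map Γ) s = 0 := by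
    refine stub_measure_eq_zero_of_analyticSet (P.map Γ) s hs fun K hKs hK => ?_
    rw [Measure.map_apply_of_aemeasurable hΓ hK.isClosed.measurableSet]
    refine measure_mono_null (fun ω hω => ?_) (ae_iff.1 h)
    exact fun hn => hn (hKs hω)
  rw [ae_iff]
  refine measure_mono_null (fun x hx => ?_) hzero
  simpa using hx

/-! ### Non-removability of the trace is an analytic condition -/

/-- **The set of curve classes with non-removable trace is analytic.** For every open `Ω ⊆ ℂ`,
`{γ : CurveClass ℂ | ¬ IsConformallyRemovableIn Ω γ.range}` is an analytic subset of the Polish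
space `CurveClass ℂ` (assembled from the three stub files: holomorphy off the trace and
injectivity are Borel conditions on `(γ, g) ∈ CurveClass ℂ × C(Ω, ℂ)`, and the set is the first
projection of the resulting Borel set). [folklore] -/
theorem analyticSet_setOf_not_isConformallyRemovableIn {Ω : Set ℂ} (hΩ : IsOpen Ω) :
    AnalyticSet {γ : CurveClass ℂ | ¬ IsConformallyRemovableIn Ω γ.range} :=
  stub_analyticSet_not_removable_of_measurable hΩ (stub_measurableSet_differentiableOn hΩ)
    (stub_measurableSet_injective hΩ)

/-! ### Removability of SLE_κ, `κ < 4`, on the law side -/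

/-- **Almost surely (in `ω`) the chordal SLE_κ curve, `0 < κ < 4`, has conformally removable trace
inside the domain**: Rohde–Schramm 2005 Thm 5.2 (Cayley images of the Loewner domains are Hölder
domains, `κ ≠ 4`) and Thm 6.1 (the trace is simple, `κ ≤ 4`), local Jones–Smirnov, conformal
invariance and locality of removability (`isConformallyRemovableIn_range_of_isCompactifiedImage`).
[cite: RohdeSchramm2005, Thm 5.2 and Thm 6.1] -/
theorem ae_isConformallyRemovableIn_range_of_isSLECurve {κ : ℝ≥0} (h0 : 0 < κ) (h4 : κ < 4)
    {D : DobrushinDomain} {Γ : (ℝ≥0 → ℝ) → CurveClass ℂ} (hΓ : IsSLECurve κ D Γ) :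
    ∀ᵐ ω ∂preWienerMeasure, IsConformallyRemovableIn D.carrier (Γ ω).range := by
  -- adapted from `Summit.CriticalPhenomena.SAWScalingLimit.Theorems.SLERemovableChord_proof`
  obtain ⟨-, φ, hφ, hae⟩ := hΓ
  have hHol : ∀ᵐ ω ∂preWienerMeasure, ∀ n : ℕ,
      IsHolderDomain (cayleyFun '' Loewner.domain (sleDriving κ ω) ((n : ℝ≥0) + 1)) :=
    ae_all_iff.2 fun n =>
      RohdeSchramm2005_isHolderDomain_cayley_domain_holds _ h0.ne' h4.ne _ (by positivity)
  have hsimple : ∀ᵐ ω ∂preWienerMeasure, Loewner.IsSimpleTrace (sleTrace κ ω) :=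
    ae_isSimpleTrace_sleTrace_of_le_four_holds h0 h4.le
  filter_upwards [hae, hHol, hsimple] with ω hω hHol hs
  obtain ⟨hgen, c, hΓω, hc⟩ := hω
  have hrange : (Γ ω).range = c.range := by rw [hΓω, CurveClass.range_mk]
  have ha : φ.boundaryExtension (sleTrace κ ω 0) ∉ D.carrier := by
    rw [sleTrace_zero, hφ.boundaryExtension_zero]
    exact fun h => (D.pt_mem_frontier 0).2 (by rwa [D.isOpen.interior_eq])
  rw [hrange]
  exact Theorems.isConformallyRemovableIn_range_of_isCompactifiedImage (continuous_sleDriving _ ω)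
    hgen hs hHol D φ ha hc

/-- **Every chordal SLE_κ law, `0 < κ < 4`, is carried by curves with conformally removable
trace.** If `P` is a chordal SLE_κ law in the Dobrushin domain `D` then `P`-almost every curve
class `γ` has `γ.range` conformally removable inside `D.carrier`. The almost-sure statement in `ω`
(`ae_isConformallyRemovableIn_range_of_isSLECurve`) is pushed to the law through the ANALYTIC bad
set (`analyticSet_setOf_not_isConformallyRemovableIn`, `ae_map_notMem_of_analyticSet`).
[cite: RohdeSchramm2005, Thm 5.2 and Thm 6.1] -/
theorem ae_isConformallyRemovableIn_of_isSLELaw {κ : ℝ≥0} (h0 : 0 < κ) (h4 : κ < 4)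
    {D : DobrushinDomain} {P : Measure (CurveClass ℂ)} (h : IsSLELaw κ D P) :
    ∀ᵐ γ ∂P, IsConformallyRemovableIn D.carrier γ.range := by
  obtain ⟨Γ, hΓ, rfl⟩ := h
  haveI : IsProbabilityMeasure preWienerMeasure := isProbabilityMeasure_preWienerMeasure'
  have hbad := ae_map_notMem_of_analyticSet hΓ.1
    (analyticSet_setOf_not_isConformallyRemovableIn D.isOpen)
    ((ae_isConformallyRemovableIn_range_of_isSLECurve h0 h4 hΓ).mono fun ω hω => by simpa using hω)
  exact hbad.mono fun γ hγ => by simpa using hγ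

/-- **An SLE₈/₃ law in `Q.chord 0 2` is carried by removable simple chords of
`(Q.carrier; Q.pt 0, Q.pt 2)`** — the conclusion of the crux `RemovableLimit` for such a law,
verbatim: simplicity and boundary avoidance by `IsSLELaw.ae_simple` (RS05 Thm 6.1), endpoints and
closure by `IsSLELaw.ae_endpoints` (Carathéodory), removability by
`ae_isConformallyRemovableIn_of_isSLELaw` in the self-map clause (`IsConformallyRemovableIn.self_maps`).
[folklore] -/
theorem ae_removableSimpleChord_of_isSLELaw (Q : ConformalRectangle) {P : Measure (CurveClass ℂ)}
    (h : IsSLELaw ((8 : ℝ≥0) / 3) (Q.chord 0 2 (by decide)) P) :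
    ∀ᵐ γ ∂P, (γ ∈ CurveClass.simple ∧ γ.source = Q.pt 0 ∧ γ.target = Q.pt 2 ∧
        γ.range ⊆ closure Q.carrier ∧ γ.range ∩ frontier Q.carrier ⊆ {Q.pt 0, Q.pt 2}) ∧
      (∀ F : ℂ → ℂ, ContinuousOn F Q.carrier → Set.InjOn F Q.carrier → F '' Q.carrier = Q.carrier →
        DifferentiableOn ℂ F (Q.carrier \ γ.range) → DifferentiableOn ℂ F Q.carrier) := by
  have hκ0 : (0 : ℝ≥0) < (8 : ℝ≥0) / 3 := by positivity
  have hκ4 : (8 : ℝ≥0) / 3 < 4 := by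
    rw [div_lt_iff₀ (by norm_num : (0 : ℝ≥0) < 3)]
    norm_num
  have h1 := h.ae_simple ae_isSimpleTrace_sleTrace_of_le_four_holds
    CurveClass.measurableSet_simple_holds hκ0 hκ4.le
  have h2 := h.ae_endpoints JordanDomain.mapsTo_boundaryExtension_holds
  have h3 := ae_isConformallyRemovableIn_of_isSLELaw hκ0 hκ4 h
  filter_upwards [h1, h2, h3] with γ h1 h2 h3
  exact ⟨⟨h1.1, h2.1, h2.2.1, h2.2.2, h1.2⟩, h3.self_maps⟩

/-! ### (R) from the identification of the limit law -/

/-- **`SubseqIdentification → RemovableLimit`**: if every subsequential weak limit of the critical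
SAW laws is the chordal SLE₈/₃ law (shared crux stmt-CriticalPhenomena-0783), then every such
limit is carried by removable simple chords (crux stmt-CriticalPhenomena-4503): specialise to the
Dobrushin domain `Q.chord 0 2` and apply `ae_removableSimpleChord_of_isSLELaw`. [folklore] -/
theorem removableLimit_of_subseqIdentification
    (hI : SAWLoopFugacityFlow.SubseqIdentification) : SAWWeldingIdentification.RemovableLimit := by
  intro Q a b hab P hP δs hpos hδ hlim
  have hδ' : Tendsto δs atTop (𝓝[>] (0 : ℝ)) :=
    tendsto_nhdsWithin_iff.2 ⟨hδ, Eventually.of_forall hpos⟩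
  exact ae_removableSimpleChord_of_isSLELaw Q (hI (Q.chord 0 2 (by decide)) a b hab δs P hδ' hP hlim)

/-- **`WeldingLawOfLimit → RemovableLimit`**: inside route `SAWWeldingIdentification` the crux (R)
(stmt-4503, rank 3) is a COROLLARY of the crux (W) (stmt-4502, rank 2) alone — (W) identifies every
subsequential limit as an SLE₈/₃ law (`isSLELaw_of_weldingLawOfLimit`: chord support from (W),
one-sided welding rigidity, disintegration), and SLE₈/₃ laws are carried by removable simple
chords (`ae_removableSimpleChord_of_isSLELaw`). [folklore] -/
theorem removableLimit_of_weldingLawOfLimit : Summit.CriticalPhenomena.SAWScalingLimit.Theses.SAWWeldingIdentification.WeldingLawOfLimit → Summit.CriticalPhenomena.SAWScalingLimit.Theses.SAWWeldingIdentification.RemovableLimit :=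
  fun hW Q a b hab P hP δs hpos hδ hlim =>
    ae_removableSimpleChord_of_isSLELaw Q (isSLELaw_of_weldingLawOfLimit hW Q a b hab P hP δs hpos hδ hlim)

/-- **Honesty certificate `SAWScalingLimit → RemovableLimit`**: the crux (R) is implied by the
summit conjunct — under convergence in law to SLE₈/₃ every subsequential weak limit is the SLE₈/₃
law (`isSLELaw_of_weakLimit`, uniqueness of weak limits), which is carried by removable simple
chords. Together with `simpleSubseqLimits_of_removableLimit`:
`SAWScalingLimit → RemovableLimit → SimpleSubseqLimits`. [folklore] -/
theorem removableLimit_of_sawScalingLimit (hS : _root_.SAWScalingLimit) :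
    SAWWeldingIdentification.RemovableLimit := by
  intro Q a b hab P hP δs hpos hδ hlim
  have hδ' : Tendsto δs atTop (𝓝[>] (0 : ℝ)) :=
    tendsto_nhdsWithin_iff.2 ⟨hδ, Eventually.of_forall hpos⟩
  exact ae_removableSimpleChord_of_isSLELaw Q
    (SimpleSubseqLimits.Negative.isSLELaw_of_weakLimit (hS _ a b hab) hδ' hlim)

end Summit.CriticalPhenomena.SAWScalingLimit.Theorems.RemovableLimit

end
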